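import Summits.QuantumFields.YangMills.Theorems.ColdStartUniversalityLatticeLangevinWilsonSemigroupPoincareSmoothing
import HarnessLib

/-!
# Route `ColdStartUniversality` (fixed-cut-off `L²(μ_{β'})` package): `L²` DECAY AT RATE `λ` BOUNDS EVERY INTEGRATED
# AUTOCORRELATION BY `Var/λ` — the converse half of «`sup_G τ_int(G) = 1/gap`»

Helper file (seat `ym-line-csu-p1`, g17; `--supports stmt-QuantumFields-27363`).  Companion of `…WilsonAutocorrelationToGap` (which proves
«uniform `τ_int` bound `A` ⇒ `L²` rate `1/A`»).  Here the easy direction, stated for an ARBITRARY rate `λ > 0` taken as a hypothesis (g16's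
`integral_autocorrelation_le` has it for the Doeblin rate of `wilson_spectralGap` only):

* `integral_mul_transition_le_exp_of_decay` — decay `∫ (κ_tG − μG)² dμ ≤ e^{−2λt} Var_μ(G)` (all continuous `G`, all `t`) gives, for the
  stationary autocorrelation function at real lattice time `u ≥ 0`, `⟨G₀, κ_u G₀⟩_μ ≤ e^{−λu} Var_μ(G)` (`⟨G₀, κ_{2s}G₀⟩ = ‖κ_sG₀‖²`).
* ★ `autocorrelation_integral_le_of_integral_sq_transition_sub_le_exp` — hence `∫₀^{T'} ⟨G₀, κ_t G₀⟩_μ dt ≤ λ⁻¹ Var_μ(G)` for every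
  `T' ≥ 0`: the hypothesis shape of `semigroupPoincare_of_autocorrelation_integral_le` with `A = 1/λ`.  Together: at fixed cut-off the best
  uniform `τ_int` bound and the best `L²` rate are reciprocal, kernel-checked without spectral theory.

THEOREMS ONLY, no definition, no sorry.  HONEST FRAMING: RECORD-rung R3 plumbing at FIXED cut-off; nothing K-uniform is proved; no crux,
rung or summit statement is proved; the Yang–Mills mass gap is NOT proved.
-/

set_option autoImplicit false

noncomputable section

namespace Summit.QuantumFields.YangMills.Theorems.ColdStartUniversality

open MeasureTheory ProbabilityTheory Filter Set Topology
open scoped BigOperators NNReal ENNReal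
open Literature.Probability.Process Literature.MathematicalPhysics.QuantumFieldTheory
open Literature.MathematicalPhysics.QuantumLattice (fundamentalRep fundamentalLatticeRep continuous_fundamentalRep)

variable {L : ℕ} [NeZero L]

/-- **Decay of variances ⇒ decay of autocorrelations**: if `∫ (κ_tH − μH)² dμ ≤ e^{−2λt} Var_μ(H)` for all continuous `H` and all `t`, then
for continuous `G` and real `u ≥ 0`, `∫ (G − μG)(κ_u G − μG) dμ ≤ e^{−λu} Var_μ(G)` (`= ‖κ_{u/2}(G − μG)‖²`, `integral_mul_transition_self_eq_sq`).
[cite: BakryGentilLedoux2014, Thm 4.2.5] -/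
theorem integral_mul_transition_le_exp_of_decay (L : ℕ) [NeZero L] (β' : ℝ)
    (κ : ℝ≥0 → Kernel (GaugeConfig 3 L (Matrix.specialUnitaryGroup (Fin 2) ℂ))
      (GaugeConfig 3 L (Matrix.specialUnitaryGroup (Fin 2) ℂ))) [∀ t, IsMarkovKernel (κ t)]
    (hreal : ∀ (t : ℝ≥0) (x : GaugeConfig 3 L (Matrix.specialUnitaryGroup (Fin 2) ℂ))
        (Ω : Type) [MeasurableSpace Ω] (P : Measure Ω) [IsProbabilityMeasure P]
        (W : ℝ≥0 → Ω → (Edge 3 L × NoiseIdx 2 → ℝ)) (hW : IsFlatBrownian W P)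
        (U : ℝ≥0 → Ω → GaugeConfig 3 L (Matrix.specialUnitaryGroup (Fin 2) ℂ)),
        (∀ ω, U 0 ω = x) →
        (latticeLangevinDynamics (fundamentalLatticeRep 2) β').IsSolution (fundamentalRep (Fin 2))
          hW.natFiltration P W U →
        κ t x = P.map (U t))
    {lam : ℝ}
    (hdecay : ∀ H : GaugeConfig 3 L (Matrix.specialUnitaryGroup (Fin 2) ℂ) → ℝ, Continuous H → ∀ t : ℝ≥0,
      ∫ x, ((∫ y, H y ∂(κ t x)) - ∫ z, H z ∂(wilsonMeasure (d := 3) (L := L) (fundamentalRep (Fin 2)) β')) ^ 2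
          ∂(wilsonMeasure (d := 3) (L := L) (fundamentalRep (Fin 2)) β') ≤
        Real.exp (-2 * lam * t) *
          ∫ x, (H x - ∫ z, H z ∂(wilsonMeasure (d := 3) (L := L) (fundamentalRep (Fin 2)) β')) ^ 2
            ∂(wilsonMeasure (d := 3) (L := L) (fundamentalRep (Fin 2)) β'))
    {G : GaugeConfig 3 L (Matrix.specialUnitaryGroup (Fin 2) ℂ) → ℝ} (hG : Continuous G) {u : ℝ} (hu : 0 ≤ u) :
    ∫ x, (G x - ∫ z, G z ∂(wilsonMeasure (d := 3) (L := L) (fundamentalRep (Fin 2)) β')) *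
        ((∫ y, G y ∂(κ u.toNNReal x)) - ∫ z, G z ∂(wilsonMeasure (d := 3) (L := L) (fundamentalRep (Fin 2)) β'))
        ∂(wilsonMeasure (d := 3) (L := L) (fundamentalRep (Fin 2)) β') ≤
      Real.exp (-lam * u) *
        ∫ x, (G x - ∫ z, G z ∂(wilsonMeasure (d := 3) (L := L) (fundamentalRep (Fin 2)) β')) ^ 2
          ∂(wilsonMeasure (d := 3) (L := L) (fundamentalRep (Fin 2)) β') := by
  classical
  haveI := secondCountableTopology_su2
  haveI := borelSpace_config L
  set μ : Measure (GaugeConfig 3 L (Matrix.specialUnitaryGroup (Fin 2) ℂ)) :=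
    wilsonMeasure (d := 3) (L := L) (fundamentalRep (Fin 2)) β' with hμ
  haveI : IsProbabilityMeasure μ :=
    isProbabilityMeasure_wilsonMeasure (d := 3) (L := L) (fundamentalRep (Fin 2)) (continuous_fundamentalRep (Fin 2)) β'
  set m : ℝ := ∫ z, G z ∂μ with hm
  set G₀ : GaugeConfig 3 L (Matrix.specialUnitaryGroup (Fin 2) ℂ) → ℝ := fun x => G x - m with hG₀
  have hG₀c : Continuous G₀ := hG.sub continuous_const
  obtain ⟨M, hM0, hM⟩ := exists_abs_le_of_continuous hG
  have hGi : ∀ (ν : Measure (GaugeConfig 3 L (Matrix.specialUnitaryGroup (Fin 2) ℂ))) [IsProbabilityMeasure ν],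
      Integrable G ν := fun ν _ =>
    Integrable.of_bound hG.aestronglyMeasurable M (Eventually.of_forall fun z => by rw [Real.norm_eq_abs]; exact hM z)
  have hκG₀ : ∀ (v : ℝ≥0) x, ∫ y, G₀ y ∂(κ v x) = (∫ y, G y ∂(κ v x)) - m := by
    intro v x
    simp only [hG₀]
    rw [integral_sub (hGi _) (integrable_const m), integral_const, probReal_univ, one_smul]
  -- `u = s + s` with `s = u/2`
  set s : ℝ≥0 := (u / 2).toNNReal with hs
  have hus : u.toNNReal = s + s := by
    rw [hs, ← Real.toNNReal_add (by linarith) (by linarith), add_halves]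
  have hsR : (s : ℝ) = u / 2 := by rw [hs, Real.coe_toNNReal _ (by linarith)]
  -- `∫ G₀ κ_{s+s} G₀ = ∫ (κ_s G − m)² ≤ e^{−2λs} Var = e^{−λu} Var`
  have e1 : ∫ x, (G x - m) * ((∫ y, G y ∂(κ u.toNNReal x)) - m) ∂μ = ∫ x, G₀ x * (∫ y, G₀ y ∂(κ (s + s) x)) ∂μ := by
    rw [hus]
    refine integral_congr_ae (Eventually.of_forall fun x => ?_)
    beta_reduce
    rw [hκG₀ (s + s) x]
  have e2 : ∫ x, G₀ x * (∫ y, G₀ y ∂(κ (s + s) x)) ∂μ = ∫ x, ((∫ y, G y ∂(κ s x)) - m) ^ 2 ∂μ := by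
    rw [integral_mul_transition_self_eq_sq L β' κ hreal s hG₀c]
    exact integral_congr_ae (Eventually.of_forall fun x => by simp only [hκG₀ s x])
  have e3 : Real.exp (-2 * lam * (s : ℝ)) = Real.exp (-lam * u) := by
    congr 1; rw [hsR]; ring
  have h := hdecay G hG s
  rw [e3] at h
  rw [e1, e2]
  exact h

/-- ★ **Decay at rate `λ > 0` ⇒ every integrated autocorrelation is at most `Var/λ`**: for continuous `G` and every horizon `T' ≥ 0`,
`∫₀^{T'} ⟨G₀, κ_t G₀⟩_μ dt ≤ λ⁻¹ Var_μ(G)` (`∫₀^{T'} e^{−λt} dt ≤ 1/λ`).  This is the hypothesis of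
`semigroupPoincare_of_autocorrelation_integral_le` with `A = λ⁻¹`: at fixed cut-off «best uniform `τ_int` bound» = «1/(best `L²` rate)».
[cite: BakryGentilLedoux2014, §4.2 (Poincaré constant as relaxation time)] -/
theorem autocorrelation_integral_le_of_integral_sq_transition_sub_le_exp (L : ℕ) [NeZero L] (β' : ℝ)
    (κ : ℝ≥0 → Kernel (GaugeConfig 3 L (Matrix.specialUnitaryGroup (Fin 2) ℂ))
      (GaugeConfig 3 L (Matrix.specialUnitaryGroup (Fin 2) ℂ))) [∀ t, IsMarkovKernel (κ t)]
    (hreal : ∀ (t : ℝ≥0) (x : GaugeConfig 3 L (Matrix.specialUnitaryGroup (Fin 2) ℂ))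
        (Ω : Type) [MeasurableSpace Ω] (P : Measure Ω) [IsProbabilityMeasure P]
        (W : ℝ≥0 → Ω → (Edge 3 L × NoiseIdx 2 → ℝ)) (hW : IsFlatBrownian W P)
        (U : ℝ≥0 → Ω → GaugeConfig 3 L (Matrix.specialUnitaryGroup (Fin 2) ℂ)),
        (∀ ω, U 0 ω = x) →
        (latticeLangevinDynamics (fundamentalLatticeRep 2) β').IsSolution (fundamentalRep (Fin 2))
          hW.natFiltration P W U →
        κ t x = P.map (U t))
    {lam : ℝ} (hlam : 0 < lam)
    (hdecay : ∀ H : GaugeConfig 3 L (Matrix.specialUnitaryGroup (Fin 2) ℂ) → ℝ, Continuous H → ∀ t : ℝ≥0,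
      ∫ x, ((∫ y, H y ∂(κ t x)) - ∫ z, H z ∂(wilsonMeasure (d := 3) (L := L) (fundamentalRep (Fin 2)) β')) ^ 2
          ∂(wilsonMeasure (d := 3) (L := L) (fundamentalRep (Fin 2)) β') ≤
        Real.exp (-2 * lam * t) *
          ∫ x, (H x - ∫ z, H z ∂(wilsonMeasure (d := 3) (L := L) (fundamentalRep (Fin 2)) β')) ^ 2
            ∂(wilsonMeasure (d := 3) (L := L) (fundamentalRep (Fin 2)) β'))
    {G : GaugeConfig 3 L (Matrix.specialUnitaryGroup (Fin 2) ℂ) → ℝ} (hG : Continuous G) {T' : ℝ} (hT' : 0 ≤ T') :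
    ∫ t in (0 : ℝ)..T', ∫ x, (G x - ∫ z, G z ∂(wilsonMeasure (d := 3) (L := L) (fundamentalRep (Fin 2)) β')) *
        ((∫ y, G y ∂(κ t.toNNReal x)) - ∫ z, G z ∂(wilsonMeasure (d := 3) (L := L) (fundamentalRep (Fin 2)) β'))
        ∂(wilsonMeasure (d := 3) (L := L) (fundamentalRep (Fin 2)) β') ≤
      lam⁻¹ * ∫ x, (G x - ∫ z, G z ∂(wilsonMeasure (d := 3) (L := L) (fundamentalRep (Fin 2)) β')) ^ 2
        ∂(wilsonMeasure (d := 3) (L := L) (fundamentalRep (Fin 2)) β') := by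
  classical
  haveI := secondCountableTopology_su2
  haveI := borelSpace_config L
  set μ : Measure (GaugeConfig 3 L (Matrix.specialUnitaryGroup (Fin 2) ℂ)) :=
    wilsonMeasure (d := 3) (L := L) (fundamentalRep (Fin 2)) β' with hμ
  haveI : IsProbabilityMeasure μ :=
    isProbabilityMeasure_wilsonMeasure (d := 3) (L := L) (fundamentalRep (Fin 2)) (continuous_fundamentalRep (Fin 2)) β'
  set m : ℝ := ∫ z, G z ∂μ with hm
  set Vr : ℝ := ∫ x, (G x - m) ^ 2 ∂μ with hVr
  have hVr0 : 0 ≤ Vr := integral_nonneg fun x => sq_nonneg _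
  -- the integrand is continuous in `t`
  set φ : ℝ → ℝ := fun t => ∫ x, (G x - m) * ((∫ y, G y ∂(κ t.toNNReal x)) - m) ∂μ with hφ
  have hGm : Continuous fun x => G x - m := hG.sub continuous_const
  have hφc : Continuous φ := by
    have hact := continuous_transitionKernel_action (L := L) β' κ hreal hG
    have hunc : Continuous (Function.uncurry fun (t : ℝ) (x : GaugeConfig 3 L (Matrix.specialUnitaryGroup (Fin 2) ℂ)) =>
        (G x - m) * ((∫ y, G y ∂(κ t.toNNReal x)) - m)) :=
      (hGm.comp continuous_snd).mul
        ((hact.comp ((continuous_real_toNNReal.comp continuous_fst).prodMk continuous_snd)).sub continuous_const)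
    have h := continuous_parametric_integral_of_continuous (μ := μ) hunc isCompact_univ
    simpa only [Measure.restrict_univ] using h
  -- pointwise bound on `[0, T']`
  have hpt : ∀ t ∈ Icc (0 : ℝ) T', φ t ≤ Real.exp (-lam * t) * Vr := fun t ht =>
    integral_mul_transition_le_exp_of_decay L β' κ hreal hdecay hG ht.1
  -- integrate the exponential
  have hexpc : Continuous fun t : ℝ => Real.exp (-lam * t) * Vr := by fun_prop
  have hI : ∫ t in (0 : ℝ)..T', Real.exp (-lam * t) * Vr = (1 - Real.exp (-lam * T')) / lam * Vr := by
    have hderiv : ∀ t ∈ Set.uIcc (0 : ℝ) T',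
        HasDerivAt (fun t : ℝ => -(Real.exp (-lam * t)) / lam * Vr) (Real.exp (-lam * t) * Vr) t := by
      intro t _
      have h1 : HasDerivAt (fun t : ℝ => -lam * t) (-lam) t := by
        simpa using (hasDerivAt_id t).const_mul (-lam)
      have h2 : HasDerivAt (fun t : ℝ => Real.exp (-lam * t)) (Real.exp (-lam * t) * (-lam)) t := h1.exp
      have h3 := ((h2.neg).div_const lam).mul_const Vr
      have e : -(Real.exp (-lam * t) * -lam) / lam * Vr = Real.exp (-lam * t) * Vr := by
        field_simp
      rw [e] at h3
      exact h3
    rw [intervalIntegral.integral_eq_sub_of_hasDerivAt hderiv (hexpc.intervalIntegrable _ _)]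
    simp only [mul_zero, Real.exp_zero]
    field_simp
    ring
  have hmono : ∫ t in (0 : ℝ)..T', φ t ≤ ∫ t in (0 : ℝ)..T', Real.exp (-lam * t) * Vr :=
    intervalIntegral.integral_mono_on hT' (hφc.intervalIntegrable _ _) (hexpc.intervalIntegrable _ _) hpt
  have hlast : (1 - Real.exp (-lam * T')) / lam * Vr ≤ lam⁻¹ * Vr := by
    rw [div_eq_mul_inv]
    have : (1 - Real.exp (-lam * T')) * lam⁻¹ ≤ 1 * lam⁻¹ :=
      mul_le_mul_of_nonneg_right (by linarith [Real.exp_pos (-lam * T')]) (inv_nonneg.2 hlam.le)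
    nlinarith [this, hVr0]
  calc ∫ t in (0 : ℝ)..T', φ t ≤ ∫ t in (0 : ℝ)..T', Real.exp (-lam * t) * Vr := hmono
    _ = (1 - Real.exp (-lam * T')) / lam * Vr := hI
    _ ≤ lam⁻¹ * Vr := hlast

end Summit.QuantumFields.YangMills.Theorems.ColdStartUniversality

end
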